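import Summits.HodgeConjecture.HodgeConjecture.Theorems.HLiu418S1MultOneFormsOfLetters
import Summits.HodgeConjecture.HodgeConjecture.Theorems.HLiu418S1BettiSliceExclusionSigned
import Summits.HodgeConjecture.HodgeConjecture.Theorems.F0AlbCmS1BettiHolds
import Summits.HodgeConjecture.HodgeConjecture.Theorems.HLiu418S1BettiSliceLinesTheta   -- T3: (L10)/(L01) on the θ-restricted letter E1θ₂
import Summits.HodgeConjecture.HodgeConjecture.Theorems.HLiu418E1Theta   -- T2: E1θantihol ⇐ E1θhol
import HarnessLib

/-!
# Crux `HLiu418`, line `F0_AlbCm` ∕ sub-sub-line `F0_AlbCmS1Betti` — ROAD (A) twin, SIGNED VARIANT ON THE θ-RESTRICTED LETTER: `stub_S1_betti_holds_theta : S1BettiShape`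
# MODULO THE FIVE LETTERS {E1θhol₂, E3₂♮hol, E3₂♮antihol, D₂h, E₂h} — E1θhol₂ = [Liu2021, Prop. D.4 (1)] verbatim (★ `Rogawski1990/CurveThetaCohFinComponentUnique`)

Floor-0 programme P5 (Alb-CM), seat F0P5-p02 (g4) («T4» of the P5 desk's word #8; twin of F0P5-p03 (g2)'s ★ `Theorems/F0AlbCmS1BettiHoldsSignedNoE1.lean` (N3,
p811554) with its hypothesis E1′hol₂ `curveCohFinComponentUnique_hol` replaced by the WEAKER θ-restricted E1θhol₂); crux item stmt-HodgeConjecture-24832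
(`HCCMUnconditional.HLiu418`).  THEOREMS ONLY, def-free, `sorry`-free; named-fact inputs are HYPOTHESES BY THEIR LITERATURE NAMES.  HC_CM is proved only modulo
the 7 printed citations until rung 0 closes.

CENSUS (for the books, desk word #8 (d)): in the parent `Lines/F0_AlbCm.lean` the packaged stub `stub_S1_facts` has EXACTLY ONE consumer, the `stub_S1_betti` slot
(`stub_S1_betti := ….stub_S1_betti_holds_… stub_S1_facts …`); the kernel chain below that slot consumes the uniqueness letter at exactly one `σ` — the theta
representation `ω⋆_lab` (`j = id`; ★ N2 :188 ∕ :310, here ★ T3 `S1BettiSliceLinesTheta`) — so E1θhol₂ is the WEAKEST statement the chain consumes, and the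
parent may read (the desk's ED. 9) `theorem stub_S1_facts : Rogawski1990.curveThetaCohFinComponentUnique_hol := by sorry` with
`stub_S1_betti := F0AlbCmS1BettiHoldsSignedTheta.stub_S1_betti_holds_theta stub_S1_facts stub_S1b_facts.1 stub_S1b_facts.2 F0P5TP2Holds.… E2LevelFinite.…`
(after ED. 8: `stub_S1b_facts` = E3hol alone and `hE3antihol := E3AntiholOfHol.curveThetaHodgeTypeSigned_antihol_of_hol stub_S1b_facts`).  E1₂ ⊇ E1′hol₂ ⊇ E1θhol₂
(★ `E1pOfE1`, ★ `E1Theta` §1), so every road that closes E1₂ or E1′hol₂ still closes the slot.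

`s1MultOneForms_of_theta_letters` = ★ N3 `s1MultOneForms_of_signed_letters'` VERBATIM (composition ★ `exists_line_of_split` of (D) ★
`CurveHodgeTypesDisjoint.hodgeTypes₂_disjoint_stable`, (L10)∕(L01), (X) ★ `S1BettiSliceExclusionSigned.stub_X_of_signed_letters`, the `(0,1)`-type letters derived
from their `(1,0)` twins by conjugation) with (L10)∕(L01) taken from ★ T3 `S1BettiSliceLinesTheta.stub_L10_of_theta_letters ∕ stub_L01_of_theta_letters` and the
antiholomorphic θ-letter DERIVED from the holomorphic one by ★ T2 `E1Theta.curveThetaCohFinComponentUnique_antihol_of_hol` (conjugation + the conjugate partner of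
the oscillator carrier ★ `exists_conjPartner_omegaAtLine_neg`, [Liu2021, Lem. D.1 (2)]).  Same conclusion TOKEN FOR TOKEN (= the body of the sub-sub-line's
`S1MultOneFormsShape`).  `stub_S1_betti_holds_theta` = ★ `F0AlbCmS1BettiHolds.s1BettiShape_of` at ★ `stub_S1_realisation` and this head; conclusion
`F0AlbCmS1BettiHolds.S1BettiShape` (= parent `F0AlbCm.S1BettiShape` token for token).

## References
* [Liu2021] Y. Liu, Camb. J. Math. 9 (2021): Prop. D.4 (1) and proof (p. 130–131); Rem. D.5 (p. 131); Lem. D.1 (2); Lem. D.2 (3).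
* [Rogawski1990] Ann. of Math. Stud. 123: §11.1 Prop. 11.1.1; Thm. 11.5.1; §12.3; Thm. 13.3.5 and 13.3.7.
* [Dixmier1977] §5.4 (5.4.1), §13.1.  [BorelJacquet1979] PSPM 33.1, §4.6.  [BorelWallach2000] VII 2.10, 3.2 and 3.6.
-/

set_option autoImplicit false
-- the mandated namespace repeats `HodgeConjecture.HodgeConjecture`, as in every `Theorems/*.lean` of this sub-problem
set_option linter.dupNamespace false

noncomputable section

namespace Summit.HodgeConjecture.HodgeConjecture.Cruxes.HLiu418.F0AlbCmS1BettiHoldsSignedTheta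

open scoped TensorProduct Matrix NumberField Kronecker ComplexOrder InnerProductSpace ENNReal
open MeasureTheory
open NumberField NumberField.InfinitePlace IsDedekindDomain
open Summit.HodgeConjecture.CorCM.Model Summit.HodgeConjecture.CorCM.Model.HComp Summit.HodgeConjecture.CorCM.HComp
open Literature.AlgebraicGeometry.Motives (CMType AbelianVariety)
open Literature.AlgebraicGeometry.ShimuraVarieties Literature.AlgebraicGeometry.ShimuraVarieties.UnitaryCanonicalModel
open Literature.NumberTheory.Automorphic Literature.NumberTheory.Automorphic.UnitaryGroup Literature.NumberTheory.Automorphic.UnitaryCurveForms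
open Literature.NumberTheory.Automorphic.UnitaryGroup.CotangentForms (toQuotFun toQuotFun_mk)
open Literature.NumberTheory.Automorphic.IdeleClassGroup Literature.NumberTheory.Automorphic.Liu2021 Literature.NumberTheory.Automorphic.Liu2021.AppendixC
open Literature.NumberTheory.GaloisRepresentations Literature.RepresentationTheory.Liu2021 Literature.RepresentationTheory.HarrisKudlaSweet1996
open Literature.AlgebraicGeometry.Liu2021 (IsAdmissibleElement)
open Literature.NumberTheory.Weil1964 Literature.NumberTheory.GelbartRogawski1991 Literature.NumberTheory.GelbartRogawski1991.UnitaryDualPair Literature.NumberTheory.GelbartRogawski1991.UnitaryDualPair.WeilCoinv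
open Literature.NumberTheory.GelbartRogawski1991.UnitaryDualPair.LocalSplitting
open Literature.NumberTheory.Automorphic.Liu2021.Def411WeilCarriersDoubling
open Literature.NumberTheory.Automorphic.Liu2021.Def411WeilCarriers (TW JW JW_eq isSymm_TW isUnit_det_TW Rep Eps epsOf Chi rhoVAtLine rhoAtLine omegaAtLine)
open Summit.HodgeConjecture.CorCM (CMField)
open Summit.HodgeConjecture.CorCM.Lines.A3Liu418
open Summit.HodgeConjecture.HodgeConjecture.Cruxes.H413.F0P3HilbertProjection
open Summit.HodgeConjecture.HodgeConjecture.Cruxes.H413.SpectrumJunction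
open Summit.HodgeConjecture.HodgeConjecture.Cruxes.HLiu418.ScalarSpectralJunction
open Summit.HodgeConjecture.HodgeConjecture.Cruxes.HLiu418.IntertwiningLineOfLetters
open Summit.HodgeConjecture.HodgeConjecture.Cruxes.HLiu418
open Summit.HodgeConjecture.HodgeConjecture.Cruxes.H413.F0P3HJ3aAssembly (left_eq_of_add_eq_add_of_disjoint right_eq_of_add_eq_add_of_disjoint)
open Summit.HodgeConjecture.HodgeConjecture.Cruxes.HLiu418.S1MultOneFormsOfLetters

set_option synthInstance.maxHeartbeats 400000 in
set_option maxHeartbeats 4000000 in  -- as the ★ twin (the `ω⋆_lab` term)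
/-- **HEAD — `S1MultOneFormsShape` MODULO FIVE LETTERS {E1θhol₂, E3₂♮hol, E3₂♮antihol, D₂h, E₂h}**: the `ω⋆_lab`-equivariant maps into the coherent
curve `1`-forms `cohForms₂ 𝔣` lie on one line.  = ★ N3 `F0AlbCmS1BettiHoldsSignedNoE1.s1MultOneForms_of_signed_letters'` with (L10)∕(L01) := ★ T3
`S1BettiSliceLinesTheta.stub_L10_of_theta_letters ∕ stub_L01_of_theta_letters` and E1θantihol := ★ T2 `E1Theta.curveThetaCohFinComponentUnique_antihol_of_hol hE1θ`.  Conclusion = the body of the sub-sub-line's `S1MultOneFormsShape`, TOKEN FOR TOKEN.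
HC_CM is proved only modulo the 7 printed citations until rung 0 closes.
[cite: Liu2021, Prop. D.4 (1) and proof (p. 130–131); Rem. D.5 (p. 131)] [cite: Rogawski1990, §11.1 Prop. 11.1.1; Thm. 11.5.1; §12.3]
[cite: BorelJacquet1979, §4.6] [cite: BorelWallach2000, VII 2.10, 3.2 and 3.6] -/
theorem s1MultOneForms_of_theta_letters (hE1θ : Literature.NumberTheory.Rogawski1990.curveThetaCohFinComponentUnique_hol)
    (hE3hol : Literature.NumberTheory.Rogawski1990.curveThetaHodgeTypeSigned_hol)
    (hE3antihol : Literature.NumberTheory.Rogawski1990.curveThetaHodgeTypeSigned_antihol)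
    (hDh : Literature.NumberTheory.Automorphic.UnitaryCurveForms.holCotFormSpectralProjection₂)
    (hEh : Literature.NumberTheory.Automorphic.UnitaryCurveForms.cohIsotypicLine₂_hol) :
      ∀ (F : CMField) [IsGalois ℚ F] (ι₁ : F →+* ℂ)
        (μ : Literature.NumberTheory.Automorphic.IdeleClassGroup (F : Type) →ₜ* Circle)
        (hμ : IdeleClassGroup.IsConjugateSymplectic (F : Type) μ)
        (_hw : IdeleClassGroup.HasWeight (F : Type) μ 1)
        (Jstar : Matrix (Fin 2) (Fin 2) (F : Type)) (t : (F : Type)) (ht : t ≠ 0) (_hτt : 0 < (ι₁ t).re) (_hτt' : (ι₁ t).im = 0)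
        (gstar : GL (Fin 2) (F : Type))
        (dJ : Fin 2 → (F : Type)) (hdJ : ∀ i, IsCMField.complexConj (F : Type) (dJ i) = dJ i) (hdJ0 : ∀ i, dJ i ≠ 0)
        (hg : formCongr ((IsCMField.complexConj (F : Type) : (F : Type) ≃ₐ[↥(maximalRealSubfield (F : Type))] (F : Type)) :
            (F : Type) →+* (F : Type)) gstar (t • Jstar) = Matrix.diagonal dJ)
        (_hsig : (∃ Tstar : GL (Fin 2) ℂ,
            formCongr (starRingEnd ℂ) Tstar ((Matrix.diagonal dJ).map ι₁) = Matrix.diagonal ![(1 : ℂ), -1]) ∧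
          ∀ τ' : (F : Type) →+* ℂ, InfinitePlace.mk τ' ≠ InfinitePlace.mk ι₁ → ((Matrix.diagonal dJ).map τ').PosDef)
        (h4 : 4 ≤ Module.finrank ℚ (F : Type))
        (r : Rep ↥(maximalRealSubfield (F : Type)) (imagUnitSq F))
        (ε : Eps ↥(maximalRealSubfield (F : Type)) (imagUnitSq F))
        (_hadm : ∃ e : (F : Type), IsAdmissibleElement (F : Type) hμ.cmType.1 e ∧
          epsOf ↥(maximalRealSubfield (F : Type)) (imagUnitSq F) (F : Type) (2 * imagUnit (F : Type))⁻¹ (-e) = ε)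
        (χ : Chi ↥(maximalRealSubfield (F : Type)) (F : Type) (IsCMField.complexConj (F : Type)))
        (𝔣 : ConeFrame (F : Type) Jstar (cmPlace (F : Type) ι₁)),
        ∃ ψ₀ : Representation.IntertwiningMap
            ((rhoVAtLine ↥(maximalRealSubfield (F : Type)) (F : Type) (IsCMField.complexConj (F : Type)) 2
              (finProdFinEquiv : Fin 2 × Fin 1 ≃ Fin (2 * 1)) (Matrix.diagonal dJ)
              (complexConj_imagUnit F) (imagUnit_ne_zero F) (imagUnit_mul_self F) (realDiagonal_isSymm F dJ hdJ)
              (isUnit_det_realDiagonal F dJ hdJ hdJ0) (realDiagonal_map F dJ hdJ).symm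
              (hsChiGS F finProdFinEquiv dJ hdJ hdJ0
                (toHeckeCharacter (F : Type) (galConj (IsCMField.complexConj (F : Type)) μ))
                (isUnitary_toHeckeCharacter (F : Type) (galConj (IsCMField.complexConj (F : Type)) μ))
                ((isOscillatorChar_toHeckeCharacter_iff (galConj (IsCMField.complexConj (F : Type)) μ)).mpr hμ.galConj))
              (r.toFun ε) χ).comp
              (finAdelicCongr ↥(maximalRealSubfield (F : Type)) (F : Type) (IsCMField.complexConj (F : Type)) gstar ht hg).symm.toMonoidHom)
            (rightRep₂ ↥(maximalRealSubfield (F : Type)) (F : Type) (IsCMField.complexConj (F : Type)) Jstar),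
          ∀ ψ : Representation.IntertwiningMap
            ((rhoVAtLine ↥(maximalRealSubfield (F : Type)) (F : Type) (IsCMField.complexConj (F : Type)) 2
              (finProdFinEquiv : Fin 2 × Fin 1 ≃ Fin (2 * 1)) (Matrix.diagonal dJ)
              (complexConj_imagUnit F) (imagUnit_ne_zero F) (imagUnit_mul_self F) (realDiagonal_isSymm F dJ hdJ)
              (isUnit_det_realDiagonal F dJ hdJ hdJ0) (realDiagonal_map F dJ hdJ).symm
              (hsChiGS F finProdFinEquiv dJ hdJ hdJ0
                (toHeckeCharacter (F : Type) (galConj (IsCMField.complexConj (F : Type)) μ))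
                (isUnitary_toHeckeCharacter (F : Type) (galConj (IsCMField.complexConj (F : Type)) μ))
                ((isOscillatorChar_toHeckeCharacter_iff (galConj (IsCMField.complexConj (F : Type)) μ)).mpr hμ.galConj))
              (r.toFun ε) χ).comp
              (finAdelicCongr ↥(maximalRealSubfield (F : Type)) (F : Type) (IsCMField.complexConj (F : Type)) gstar ht hg).symm.toMonoidHom)
            (rightRep₂ ↥(maximalRealSubfield (F : Type)) (F : Type) (IsCMField.complexConj (F : Type)) Jstar),
          (∀ w, ψ w ∈ cohForms₂ ↥(maximalRealSubfield (F : Type)) (F : Type) (IsCMField.complexConj (F : Type)) Jstar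
              (IsCMField.complexConj_ne_one (F : Type)) (UnitaryGroup.complexConj_smul_infinitePlace (F : Type))
              (cmPlace (F : Type) ι₁) 𝔣) → ∃ a : ℂ, ψ = a • ψ₀ := by
  intro F _ ι₁ μ hμ hw Jstar t ht hτt hτt' gstar dJ hdJ hdJ0 hg hsig h4 r ε hadm χ 𝔣
  obtain ⟨hAB, hA, hB⟩ := CurveHodgeTypesDisjoint.hodgeTypes₂_disjoint_stable ↥(maximalRealSubfield (F : Type)) (F : Type)
    (IsCMField.complexConj (F : Type)) Jstar (IsCMField.complexConj_ne_one (F : Type)) (UnitaryGroup.complexConj_smul_infinitePlace (F : Type))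
    (cmPlace (F : Type) ι₁) (CurveHodgeTypesDisjoint.isHermitian_map_of_formCongr (F : Type) ι₁ Jstar t ht hτt' gstar dJ hdJ hg _) 𝔣
  exact exists_line_of_split _ _ _ _ hAB hA hB
    (S1BettiSliceLinesTheta.stub_L10_of_theta_letters hE1θ hDh hEh F ι₁ μ hμ hw Jstar t ht hτt hτt' gstar dJ hdJ hdJ0 hg hsig h4 r ε hadm χ 𝔣)
    (S1BettiSliceLinesTheta.stub_L01_of_theta_letters
      (E1Theta.curveThetaCohFinComponentUnique_antihol_of_hol hE1θ)
      (Literature.NumberTheory.Automorphic.UnitaryCurveForms.antiholCotFormSpectralProjection₂_of_hol hDh)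
      (Literature.NumberTheory.Automorphic.UnitaryCurveForms.cohIsotypicLine₂_antihol_of_hol hEh)
      F ι₁ μ hμ hw Jstar t ht hτt hτt' gstar dJ hdJ hdJ0 hg hsig h4 r ε hadm χ 𝔣)
    (S1BettiSliceExclusionSigned.stub_X_of_signed_letters hE3hol hE3antihol hDh
      (Literature.NumberTheory.Automorphic.UnitaryCurveForms.antiholCotFormSpectralProjection₂_of_hol hDh)
      F ι₁ μ hμ hw Jstar t ht hτt hτt' gstar dJ hdJ hdJ0 hg hsig h4 r ε hadm χ 𝔣)

/-- **`stub_S1_betti_holds_theta` — the parent's `stub_S1_betti : S1BettiShape` MODULO THE FIVE NAMED FACTS {E1θhol, E3hol, E3antihol, TPhol, E₂hol}** (E1θhol = [Liu2021, Prop. D.4 (1)] verbatim)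
(E2′ `curveThetaHodgeTypeRigid` NOT among them): ★ `F0AlbCmS1BettiHolds.s1BettiShape_of` at ★ `F0AlbCmS1BettiHolds.stub_S1_realisation` and HEAD‴
`s1MultOneForms_of_theta_letters`.  [Liu2021, Prop. D.4 (1)]: `dim Hom_{ℂ[G]}(ω⋆, H¹_B) ≤ 1`.  HC_CM is proved only modulo the 7 printed citations until rung 0 closes.
[cite: Liu2021, Prop. D.4 (1) and proof (p. 130–131); Rem. D.5 (p. 131); §D.2 (D.1)] [cite: Rogawski1990, §11.1 Prop. 11.1.1; Thm. 11.5.1]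
[cite: BorelWallach2000, VII 3.2] -/
theorem stub_S1_betti_holds_theta (hE1θ : Literature.NumberTheory.Rogawski1990.curveThetaCohFinComponentUnique_hol)
    (hE3hol : Literature.NumberTheory.Rogawski1990.curveThetaHodgeTypeSigned_hol)
    (hE3antihol : Literature.NumberTheory.Rogawski1990.curveThetaHodgeTypeSigned_antihol)
    (hDh : Literature.NumberTheory.Automorphic.UnitaryCurveForms.holCotFormSpectralProjection₂)
    (hEh : Literature.NumberTheory.Automorphic.UnitaryCurveForms.cohIsotypicLine₂_hol) : F0AlbCmS1BettiHolds.S1BettiShape :=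
  F0AlbCmS1BettiHolds.s1BettiShape_of F0AlbCmS1BettiHolds.stub_S1_realisation
    (s1MultOneForms_of_theta_letters hE1θ hE3hol hE3antihol hDh hEh)

end Summit.HodgeConjecture.HodgeConjecture.Cruxes.HLiu418.F0AlbCmS1BettiHoldsSignedTheta

end
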